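import Mathlib.Analysis.Calculus.ContDiff.Deriv
import Mathlib.Analysis.Calculus.Deriv.Basic
import Mathlib.Analysis.SpecialFunctions.Pow.Deriv
import Mathlib.Analysis.InnerProductSpace.Calculus
import Mathlib.Analysis.InnerProductSpace.PiL2
import HarnessLib

/-!
# HarmonicShellLineGlue — plate L of ROUND-41 «IsotropicBlobPressureLaw» (S-door lane):
# gluing two real functions at a point with matching 2-jets gives a `C²` function (`deriv` currency),
# and radial composites `x ↦ φ(‖x‖²)` on a real inner-product space

For `f g : ℝ → ℝ` and a point `a`, `lineGlue a f g s := if s ≤ a then f s else g s`.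

* `hasDerivAt_lineGlue`: derivative data on the two closed half-lines matching at `a` (values and first
  derivatives) ⇒ the glued function has the glued derivative EVERYWHERE (one-sided `HasDerivWithinAt` + union).
* `contDiff_two_lineGlue` (+ `deriv_lineGlue`, `deriv_deriv_lineGlue`): `f` of class `C²` at every `s ≤ a`,
  `g` at every `s ≥ a`, and `f a = g a`, `f′ a = g′ a`, `f″ a = g″ a` ⇒ `lineGlue a f g` is `C²` on `ℝ`.
* `lineGlue_eventuallyEq_of_lt/gt`: local agreement with the pieces off the gluing point.
* `contDiff_two_lineGlue_comp_norm_sq`: the radial composite `x ↦ lineGlue a f g (‖x‖²)` is `C²`.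
* matching helpers for the ROUND-41 profiles: `hasDerivAt_const_mul_rpow` / `deriv_const_mul_rpow`
  (`(c·s^r)′ = c r s^{r−1}` at `s > 0`).

Use (ROUND-41, nsreg-p1 g33 «Glue1D»): the witness pressure `Σ_l Φ_l(‖x‖²) Z_l(x)` and the witness field have
radial profiles «polynomial on `s ≤ 1`, `c·s^{−a}` (or `0`) on `s ≥ 1`» matching to order ≥ 2 at `s = 1`.
Generic; `--supports stmt-NavierStokesRegularity-0056 --as helper`.
HONEST FRAME: elementary calculus; nothing about item 0056 `NoTypeII` or NS regularity is proved.
-/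

set_option linter.dupNamespace false

open Set Function Filter Topology

namespace Summit.NavierStokesRegularity.NavierStokesRegularity.Theorems.StrainDoors

namespace HarmonicShell

noncomputable section

/-- support (definition): the function glued at the point `a`: `f` on `(-∞, a]`, `g` on `(a, ∞)`. -/
def lineGlue (a : ℝ) (f g : ℝ → ℝ) : ℝ → ℝ := fun s => if s ≤ a then f s else g s

/-- On `s ≤ a` the glued function is `f`. -/
theorem lineGlue_of_le {a : ℝ} {f g : ℝ → ℝ} {s : ℝ} (h : s ≤ a) : lineGlue a f g s = f s := if_pos h

/-- On `a < s` the glued function is `g`. -/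
theorem lineGlue_of_lt {a : ℝ} {f g : ℝ → ℝ} {s : ℝ} (h : a < s) : lineGlue a f g s = g s :=
  if_neg (not_le.2 h)

/-- On `a ≤ s` the glued function is `g`, provided `f a = g a`. -/
theorem lineGlue_of_ge {a : ℝ} {f g : ℝ → ℝ} (h0 : f a = g a) {s : ℝ} (h : a ≤ s) : lineGlue a f g s = g s := by
  rcases h.lt_or_eq with h' | h'
  · exact lineGlue_of_lt h'
  · subst h'
    rw [lineGlue_of_le le_rfl, h0]

/-- Left of `a` the glued function agrees with `f` near the point. -/
theorem lineGlue_eventuallyEq_of_lt {a : ℝ} (f g : ℝ → ℝ) {s : ℝ} (h : s < a) : lineGlue a f g =ᶠ[𝓝 s] f := by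
  filter_upwards [Iio_mem_nhds h] with y hy
  exact lineGlue_of_le (le_of_lt hy)

/-- Right of `a` the glued function agrees with `g` near the point. -/
theorem lineGlue_eventuallyEq_of_gt {a : ℝ} (f g : ℝ → ℝ) {s : ℝ} (h : a < s) : lineGlue a f g =ᶠ[𝓝 s] g := by
  filter_upwards [Ioi_mem_nhds h] with y hy
  exact lineGlue_of_lt hy

/-- **First-order gluing.** Derivatives `f'` on `s ≤ a`, `g'` on `a ≤ s`, values and first derivatives matching
at `a` ⇒ the glued function has derivative `lineGlue a f' g' s` at EVERY `s`. -/
theorem hasDerivAt_lineGlue {a : ℝ} {f g f' g' : ℝ → ℝ}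
    (hf : ∀ s, s ≤ a → HasDerivAt f (f' s) s) (hg : ∀ s, a ≤ s → HasDerivAt g (g' s) s)
    (h0 : f a = g a) (h1 : f' a = g' a) (s : ℝ) :
    HasDerivAt (lineGlue a f g) (lineGlue a f' g' s) s := by
  rcases lt_trichotomy s a with hlt | heq | hgt
  · rw [lineGlue_of_le hlt.le]
    exact (hf s hlt.le).congr_of_eventuallyEq (lineGlue_eventuallyEq_of_lt f g hlt)
  · subst heq
    rw [lineGlue_of_le le_rfl]
    have hs : HasDerivWithinAt (lineGlue s f g) (f' s) (Iic s) s :=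
      (hf s le_rfl).hasDerivWithinAt.congr (fun y hy => lineGlue_of_le hy) (lineGlue_of_le le_rfl)
    have ht : HasDerivWithinAt (lineGlue s f g) (f' s) (Ici s) s := by
      rw [h1]
      exact (hg s le_rfl).hasDerivWithinAt.congr (fun y hy => lineGlue_of_ge h0 hy) (lineGlue_of_ge h0 le_rfl)
    have hu := hs.union ht
    rw [Iic_union_Ici] at hu
    exact hu.hasDerivAt Filter.univ_mem
  · rw [lineGlue_of_lt hgt]
    exact (hg s hgt.le).congr_of_eventuallyEq (lineGlue_eventuallyEq_of_gt f g hgt)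

/-- **Continuity of a glued function**: continuous pieces on the two closed half-lines agreeing at `a`. -/
theorem continuous_lineGlue {a : ℝ} {f g : ℝ → ℝ} (hf : ContinuousOn f (Iic a)) (hg : ContinuousOn g (Ici a))
    (h0 : f a = g a) : Continuous (lineGlue a f g) := by
  refine continuous_if_le continuous_id continuous_const (fun s hs => hf s hs) (fun s hs => hg s hs) ?_
  intro s hs
  rw [show s = a from hs, h0]

/-- **Second-order gluing** (with the glued first and second derivatives). -/
theorem contDiff_two_lineGlue_aux {a : ℝ} {f g : ℝ → ℝ}
    (hf : ∀ s, s ≤ a → ContDiffAt ℝ 2 f s) (hg : ∀ s, a ≤ s → ContDiffAt ℝ 2 g s)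
    (h0 : f a = g a) (h1 : deriv f a = deriv g a) (h2 : deriv (deriv f) a = deriv (deriv g) a) :
    ContDiff ℝ 2 (lineGlue a f g) ∧
      (∀ s, HasDerivAt (lineGlue a f g) (lineGlue a (deriv f) (deriv g) s) s) ∧
      (∀ s, HasDerivAt (lineGlue a (deriv f) (deriv g)) (lineGlue a (deriv (deriv f)) (deriv (deriv g)) s) s) := by
  have two_ne : (2 : WithTop ℕ∞) ≠ 0 := by norm_num
  have hf1 : ∀ s, s ≤ a → HasDerivAt f (deriv f s) s := fun s hs =>
    ((hf s hs).differentiableAt two_ne).hasDerivAt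
  have hg1 : ∀ s, a ≤ s → HasDerivAt g (deriv g s) s := fun s hs =>
    ((hg s hs).differentiableAt two_ne).hasDerivAt
  have hf1c : ∀ s, s ≤ a → ContDiffAt ℝ 1 (deriv f) s := fun s hs =>
    (hf s hs).derivWithin (m := 1) (by norm_num)
  have hg1c : ∀ s, a ≤ s → ContDiffAt ℝ 1 (deriv g) s := fun s hs =>
    (hg s hs).derivWithin (m := 1) (by norm_num)
  have hf2 : ∀ s, s ≤ a → HasDerivAt (deriv f) (deriv (deriv f) s) s := fun s hs =>
    ((hf1c s hs).differentiableAt one_ne_zero).hasDerivAt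
  have hg2 : ∀ s, a ≤ s → HasDerivAt (deriv g) (deriv (deriv g) s) s := fun s hs =>
    ((hg1c s hs).differentiableAt one_ne_zero).hasDerivAt
  have hf2c : ContinuousOn (deriv (deriv f)) (Iic a) := fun s hs =>
    ((hf1c s hs).derivWithin (m := 0) (by norm_num)).continuousAt.continuousWithinAt
  have hg2c : ContinuousOn (deriv (deriv g)) (Ici a) := fun s hs =>
    ((hg1c s hs).derivWithin (m := 0) (by norm_num)).continuousAt.continuousWithinAt
  have hF : ∀ s, HasDerivAt (lineGlue a f g) (lineGlue a (deriv f) (deriv g) s) s :=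
    hasDerivAt_lineGlue hf1 hg1 h0 h1
  have hF' : ∀ s, HasDerivAt (lineGlue a (deriv f) (deriv g))
      (lineGlue a (deriv (deriv f)) (deriv (deriv g)) s) s :=
    hasDerivAt_lineGlue hf2 hg2 h1 h2
  have hF''c : Continuous (lineGlue a (deriv (deriv f)) (deriv (deriv g))) := continuous_lineGlue hf2c hg2c h2
  refine ⟨?_, hF, hF'⟩
  have hd1 : deriv (lineGlue a f g) = lineGlue a (deriv f) (deriv g) := funext fun s => (hF s).deriv
  have hd2 : deriv (lineGlue a (deriv f) (deriv g)) = lineGlue a (deriv (deriv f)) (deriv (deriv g)) :=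
    funext fun s => (hF' s).deriv
  have h1' : ContDiff ℝ 1 (lineGlue a (deriv f) (deriv g)) := by
    rw [contDiff_one_iff_deriv, hd2]
    exact ⟨fun s => (hF' s).differentiableAt, hF''c⟩
  have : ContDiff ℝ ((1 : ℕ) + 1) (lineGlue a f g) := by
    rw [contDiff_succ_iff_deriv, hd1]
    refine ⟨fun s => (hF s).differentiableAt, ?_, by simpa using h1'⟩
    intro h
    exact absurd h (by norm_num)
  simpa [one_add_one_eq_two] using this

/-- **Plate L «LineGlue».** Matching 2-jets at the gluing point ⇒ the glued function is `C²`. -/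
theorem contDiff_two_lineGlue {a : ℝ} {f g : ℝ → ℝ}
    (hf : ∀ s, s ≤ a → ContDiffAt ℝ 2 f s) (hg : ∀ s, a ≤ s → ContDiffAt ℝ 2 g s)
    (h0 : f a = g a) (h1 : deriv f a = deriv g a) (h2 : deriv (deriv f) a = deriv (deriv g) a) :
    ContDiff ℝ 2 (lineGlue a f g) :=
  (contDiff_two_lineGlue_aux hf hg h0 h1 h2).1

/-- The derivative of the glued function is the glued derivative. -/
theorem deriv_lineGlue {a : ℝ} {f g : ℝ → ℝ}
    (hf : ∀ s, s ≤ a → ContDiffAt ℝ 2 f s) (hg : ∀ s, a ≤ s → ContDiffAt ℝ 2 g s)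
    (h0 : f a = g a) (h1 : deriv f a = deriv g a) (h2 : deriv (deriv f) a = deriv (deriv g) a) (s : ℝ) :
    deriv (lineGlue a f g) s = if s ≤ a then deriv f s else deriv g s :=
  ((contDiff_two_lineGlue_aux hf hg h0 h1 h2).2.1 s).deriv

/-- The second derivative of the glued function is the glued second derivative. -/
theorem deriv_deriv_lineGlue {a : ℝ} {f g : ℝ → ℝ}
    (hf : ∀ s, s ≤ a → ContDiffAt ℝ 2 f s) (hg : ∀ s, a ≤ s → ContDiffAt ℝ 2 g s)
    (h0 : f a = g a) (h1 : deriv f a = deriv g a) (h2 : deriv (deriv f) a = deriv (deriv g) a) (s : ℝ) :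
    deriv (deriv (lineGlue a f g)) s = if s ≤ a then deriv (deriv f) s else deriv (deriv g) s := by
  obtain ⟨-, hF, hF'⟩ := contDiff_two_lineGlue_aux hf hg h0 h1 h2
  have hd1 : deriv (lineGlue a f g) = lineGlue a (deriv f) (deriv g) := funext fun t => (hF t).deriv
  rw [hd1]
  exact (hF' s).deriv

/-! ## Radial composites `x ↦ φ(‖x‖²)` -/

section Radial

variable {E : Type*} [NormedAddCommGroup E] [InnerProductSpace ℝ E]

/-- A `C²` profile of `‖x‖²` is `C²` on the space. -/
theorem contDiff_two_comp_norm_sq {φ : ℝ → ℝ} (hφ : ContDiff ℝ 2 φ) :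
    ContDiff ℝ 2 (fun x : E => φ (‖x‖ ^ 2)) :=
  hφ.comp (contDiff_norm_sq ℝ)

/-- **The radial glued composite is `C²`**: `x ↦ lineGlue a f g (‖x‖²)` under matching 2-jets at `a`. -/
theorem contDiff_two_lineGlue_comp_norm_sq {a : ℝ} {f g : ℝ → ℝ}
    (hf : ∀ s, s ≤ a → ContDiffAt ℝ 2 f s) (hg : ∀ s, a ≤ s → ContDiffAt ℝ 2 g s)
    (h0 : f a = g a) (h1 : deriv f a = deriv g a) (h2 : deriv (deriv f) a = deriv (deriv g) a) :
    ContDiff ℝ 2 (fun x : E => lineGlue a f g (‖x‖ ^ 2)) :=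
  contDiff_two_comp_norm_sq (contDiff_two_lineGlue hf hg h0 h1 h2)

omit [InnerProductSpace ℝ E] in
/-- Inside the ball `‖x‖² < a` the radial glued composite is locally `f(‖x‖²)`. -/
theorem lineGlue_comp_norm_sq_eventuallyEq_of_lt {a : ℝ} (f g : ℝ → ℝ) {x : E} (h : ‖x‖ ^ 2 < a) :
    (fun y : E => lineGlue a f g (‖y‖ ^ 2)) =ᶠ[𝓝 x] fun y => f (‖y‖ ^ 2) := by
  have hc : Continuous fun y : E => ‖y‖ ^ 2 := (continuous_norm).pow 2
  filter_upwards [hc.continuousAt.preimage_mem_nhds (Iio_mem_nhds h)] with y hy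
  exact lineGlue_of_le (le_of_lt hy)

omit [InnerProductSpace ℝ E] in
/-- Outside the ball `a < ‖x‖²` the radial glued composite is locally `g(‖x‖²)`. -/
theorem lineGlue_comp_norm_sq_eventuallyEq_of_gt {a : ℝ} (f g : ℝ → ℝ) {x : E} (h : a < ‖x‖ ^ 2) :
    (fun y : E => lineGlue a f g (‖y‖ ^ 2)) =ᶠ[𝓝 x] fun y => g (‖y‖ ^ 2) := by
  have hc : Continuous fun y : E => ‖y‖ ^ 2 := (continuous_norm).pow 2
  filter_upwards [hc.continuousAt.preimage_mem_nhds (Ioi_mem_nhds h)] with y hy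
  exact lineGlue_of_lt hy

end Radial

/-! ## Matching helpers for power-law exterior branches `c·s^r` -/

/-- `(c·s^r)′ = c·r·s^{r−1}` at `s > 0`. -/
theorem hasDerivAt_const_mul_rpow (c r : ℝ) {s : ℝ} (hs : 0 < s) :
    HasDerivAt (fun t : ℝ => c * t ^ r) (c * (r * s ^ (r - 1))) s :=
  (Real.hasDerivAt_rpow_const (Or.inl hs.ne')).const_mul c

/-- `deriv (c·s^r) = c·r·s^{r−1}` at `s > 0`. -/
theorem deriv_const_mul_rpow (c r : ℝ) {s : ℝ} (hs : 0 < s) :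
    deriv (fun t : ℝ => c * t ^ r) s = c * (r * s ^ (r - 1)) :=
  (hasDerivAt_const_mul_rpow c r hs).deriv

/-- Near `s > 0`, `deriv (c·t^r)` is the function `t ↦ c·r·t^{r−1}`. -/
theorem deriv_const_mul_rpow_eventuallyEq (c r : ℝ) {s : ℝ} (hs : 0 < s) :
    deriv (fun t : ℝ => c * t ^ r) =ᶠ[𝓝 s] fun t => c * (r * t ^ (r - 1)) := by
  filter_upwards [Ioi_mem_nhds hs] with t ht
  exact deriv_const_mul_rpow c r ht

/-- `deriv (deriv (c·s^r)) = c·r·(r−1)·s^{r−2}` at `s > 0`. -/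
theorem deriv_deriv_const_mul_rpow (c r : ℝ) {s : ℝ} (hs : 0 < s) :
    deriv (deriv (fun t : ℝ => c * t ^ r)) s = c * (r * ((r - 1) * s ^ (r - 1 - 1))) := by
  rw [(deriv_const_mul_rpow_eventuallyEq c r hs).deriv_eq]
  have h := hasDerivAt_const_mul_rpow (c * r) (r - 1) hs
  have hfun : (fun t : ℝ => c * r * t ^ (r - 1)) = fun t => c * (r * t ^ (r - 1)) := by
    funext t; ring
  rw [hfun] at h
  rw [h.deriv]
  ring

/-- `c·s^r` is `C^n` at every `s > 0`. -/
theorem contDiffAt_const_mul_rpow (c r : ℝ) {n : WithTop ℕ∞} {s : ℝ} (hs : 0 < s) :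
    ContDiffAt ℝ n (fun t : ℝ => c * t ^ r) s :=
  contDiffAt_const.mul (Real.contDiffAt_rpow_const_of_ne hs.ne')

end

end HarmonicShell

end Summit.NavierStokesRegularity.NavierStokesRegularity.Theorems.StrainDoors
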